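import Literature.LinearAlgebra.Matrix.NonderogatoryCommutant
import Literature.NumberTheory.EllipticCurves.DeligneSerreWeightOneLemmas
import Mathlib.LinearAlgebra.Eigenspace.Charpoly
import Mathlib.LinearAlgebra.Eigenspace.Minpoly
import Mathlib.FieldTheory.IsAlgClosed.AlgebraicClosure
import Mathlib.FieldTheory.Separable
import HarnessLib

/-!
# The commutant of a nonderogatory matrix under base change: over ANY commutative algebra `R ⊇ K` the matrices commuting
# with `A ⊗ 1` (`A ∈ M_n(K)`, `q_A = p_A`, e.g. `p_A` separable) are the polynomials in `A ⊗ 1`, hence commute with each other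
(Horn–Johnson, *Matrix Analysis* (2013), Thm. 3.2.4.2 ∕ 3.2.P1 ∕ 3.3.P17; the cyclic-vector proof is ring-valid)

Topic `LinearAlgebra/Matrix`; namespace `Literature.LinearAlgebra.Matrix`; THEOREMS ONLY (no def, no instance, no named fact, no
`sorry`), on top of ★ `NonderogatoryCommutant` ∕ ★ `CyclicVectorCompanionMatrix` ∕ ★ `CompanionMatrix`.

WHY (consumer: the floor-0 ENGINE line's orbital measure families).  The centraliser of a REGULAR SEMISIMPLE rational element
`γ ∈ U(H)(L⁺) ≤ GL_n(L)` is needed COMMUTATIVE not only in `GL_n(L)` (★ `commute_of_forall_commute_nonderogatory`, a field) but in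
`GL_n(L ⊗ L⁺_v) = GL_n(∏_{w∣v} L_w)` (the local groups) and in `GL_n(𝔸_L)` (the adelic group) — matrices over commutative
`L`-ALGEBRAS that are not fields.  The printed proof via distinct eigenvalues needs a field; the cyclic-vector proof does not:

* §1 `exists_eq_aeval_companion_of_commute_ring` — over ANY commutative ring, a matrix commuting with a COMPANION matrix `C` is
  `p(C)` (`e₁` is cyclic: `B e_{j+1} = B C^j e₁ = C^j B e₁ = C^j p(C) e₁ = p(C) e_{j+1}`); `commute_of_commute_companion_ring`.
* §2 `exists_eq_aeval_map_of_commute` — `A ∈ M_n(K)` with `minpoly K A = A.charpoly`, `R` any commutative `K`-algebra: every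
  `B ∈ M_n(R)` commuting with `A.map (algebraMap K R)` is `aeval (A.map (algebraMap K R)) p`, `p ∈ R[X]` (conjugate to the companion
  matrix over `K`, ★ `minpoly_eq_charpoly_iff_exists_conj_eq_companion`, and base-change the conjugation);
  **`commute_of_commute_map_of_minpoly_eq_charpoly`** — two such `B`, `B′` commute.
* §3 `minpoly_eq_charpoly_of_charpoly_separable` — a matrix with SEPARABLE characteristic polynomial is nonderogatory (over the
  algebraic closure the `n` distinct eigenvalues are roots of the minimal polynomial, ★ `DeligneSerre1974.isRoot_minpoly_of_isRoot_charpoly`); **`commute_of_commute_map_of_charpoly_separable`**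
  (the field case `R = K` is ★ `CentraliserOfSeparableCharpoly.commute_of_commute_of_charpoly_separable`, A-p06).

## References
* R. A. Horn, C. R. Johnson, *Matrix Analysis*, 2nd ed. (CUP 2013), Thm. 3.2.4.2 p. 236 (print: p0236 of the held text), 3.2.P1,
  Thm. 3.3.15, 3.3.P17 [HornJohnson2013].
-/

open Matrix Polynomial Module

namespace Literature.LinearAlgebra.Matrix

universe u

/-! ## §1 The commutant of a companion matrix over a commutative ring -/

section CompanionRing

variable {R : Type*} [CommRing R]

/-- **3.3.P17 over a commutative RING**: a matrix commuting with the companion matrix `C = companion a` is a polynomial in `C` of degree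
`< n` — `B = Σ_k B_{k,1} C^k`, read off from the first column (`e₁` is a cyclic vector: `C^k e₁ = e_{k+1}`, ★
`companion_pow_mulVec_single_zero`, over any commutative ring). [cite: HornJohnson2013, 3.3.P17, p0260] -/
theorem exists_eq_aeval_companion_of_commute_ring {m : ℕ} (a : Fin m → R) (B : Matrix (Fin m) (Fin m) R)
    (hB : Commute (companion a) B) : ∃ p : R[X], p.degree < (m : ℕ) ∧ B = aeval (companion a) p := by
  rcases m with _ | n
  · exact ⟨0, by simp, Subsingleton.elim _ _⟩
  -- the first column of `B` as a polynomial
  refine ⟨∑ k : Fin (n + 1), C (B k 0) * X ^ (k : ℕ), degree_sum_fin_lt _, ?_⟩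
  set P : Matrix (Fin (n + 1)) (Fin (n + 1)) R := aeval (companion a) (∑ k : Fin (n + 1), C (B k 0) * X ^ (k : ℕ)) with hP
  -- `P e₁ = B e₁`
  have hP0 : P *ᵥ Pi.single 0 1 = B *ᵥ Pi.single 0 1 := by
    have hPsum : P = ∑ k : Fin (n + 1), B k 0 • companion a ^ (k : ℕ) := by
      rw [hP, map_sum]
      refine Finset.sum_congr rfl fun k _ => ?_
      rw [map_mul, aeval_C, map_pow, aeval_X, Algebra.smul_def]
    rw [hPsum, Matrix.sum_mulVec, Matrix.mulVec_single_one]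
    funext i
    rw [Finset.sum_apply, Finset.sum_eq_single i (fun k _ hki => ?_) (fun h => absurd (Finset.mem_univ i) h)]
    · rw [Matrix.smul_mulVec, companion_pow_mulVec_single_zero a i i.2, Fin.eta, Pi.smul_apply, Pi.single_eq_same,
        smul_eq_mul, mul_one, Matrix.col_apply]
    · rw [Matrix.smul_mulVec, companion_pow_mulVec_single_zero a k k.2, Fin.eta, Pi.smul_apply, Pi.single_eq_of_ne hki.symm,
        smul_zero]
  -- `P` commutes with `C`
  have hPC : Commute (companion a) P := by
    have h : companion a = aeval (companion a) (X : R[X]) := (aeval_X _).symm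
    rw [hP]
    conv_lhs => rw [h]
    exact (Commute.all (X : R[X]) _).map (aeval (companion a))
  -- compare the columns `e_{k+1} = C^k e₁`
  ext i k
  have hk : Pi.single k (1 : R) = (companion a ^ (k : ℕ)) *ᵥ Pi.single (0 : Fin (n + 1)) 1 := by
    rw [companion_pow_mulVec_single_zero a k k.2, Fin.eta]
  have hcolB : B *ᵥ Pi.single k 1 = (companion a ^ (k : ℕ)) *ᵥ (B *ᵥ Pi.single 0 1) := by
    rw [hk, Matrix.mulVec_mulVec, ← (hB.pow_left (k : ℕ)).eq, ← Matrix.mulVec_mulVec]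
  have hcolP : P *ᵥ Pi.single k 1 = (companion a ^ (k : ℕ)) *ᵥ (P *ᵥ Pi.single 0 1) := by
    rw [hk, Matrix.mulVec_mulVec, ← (hPC.pow_left (k : ℕ)).eq, ← Matrix.mulVec_mulVec]
  have h := congrFun hcolB i
  rw [hP0.symm, ← hcolP, Matrix.mulVec_single_one, Matrix.mulVec_single_one] at h
  exact h

/-- Hence **the commutant of a companion matrix over a commutative ring is commutative**. [cite: HornJohnson2013, 3.2.P1, p0247] -/
theorem commute_of_commute_companion_ring {m : ℕ} (a : Fin m → R) {B B' : Matrix (Fin m) (Fin m) R}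
    (hB : Commute (companion a) B) (hB' : Commute (companion a) B') : Commute B B' := by
  obtain ⟨p, -, hp⟩ := exists_eq_aeval_companion_of_commute_ring a B hB
  obtain ⟨q, -, hq⟩ := exists_eq_aeval_companion_of_commute_ring a B' hB'
  rw [hp, hq]
  exact (Commute.all p q).map (aeval (companion a))

/-- The companion matrix is preserved by ring homomorphisms entrywise. [cite: HornJohnson2013, (3.3.12), p0256] -/
theorem companion_map {S : Type*} [CommRing S] {m : ℕ} (a : Fin m → R) (f : R →+* S) :
    (companion a).map f = companion (f ∘ a) := by
  ext i j
  simp only [Matrix.map_apply, companion_apply, Function.comp_apply]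
  split_ifs <;> simp

end CompanionRing

/-! ## §2 Base change of a nonderogatory matrix to a commutative algebra -/

section BaseChange

variable {K : Type u} [Field K] {R : Type*} [CommRing R] [Algebra K R]

/-- **Theorem 3.2.4.2 under base change.**  For `A ∈ M_n(K)` with `q_A = p_A` and ANY commutative `K`-algebra `R`, every
`B ∈ M_n(R)` commuting with `A ⊗ 1 = A.map (algebraMap K R)` is a polynomial in `A ⊗ 1` with coefficients in `R` (conjugate `A` to its
companion matrix over `K`, ★ `minpoly_eq_charpoly_iff_exists_conj_eq_companion`, base-change the conjugation, and apply §1).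
[cite: HornJohnson2013, Thm 3.2.4.2, p0236] -/
theorem exists_eq_aeval_map_of_commute {m : ℕ} (A : Matrix (Fin m) (Fin m) K) (hA : minpoly K A = A.charpoly)
    (B : Matrix (Fin m) (Fin m) R) (hB : Commute (A.map (algebraMap K R)) B) :
    ∃ p : R[X], p.degree < (m : ℕ) ∧ B = aeval (A.map (algebraMap K R)) p := by
  obtain ⟨S, hS, hSA⟩ := (minpoly_eq_charpoly_iff_exists_conj_eq_companion A).mp hA
  set f : K →+* R := algebraMap K R with hf
  set a : Fin m → K := fun i => A.charpoly.coeff i with ha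
  -- base change of the conjugation: `S'⁻¹ A' S' = companion (f ∘ a)`
  set S' : Matrix (Fin m) (Fin m) R := S.map f with hS'
  have hS'det : IsUnit S'.det := by
    rw [hS', ← RingHom.mapMatrix_apply, ← RingHom.map_det]
    exact hS.map _
  have hS'inv : S'⁻¹ = S⁻¹.map f := by
    have h1 : S⁻¹.map f * S' = 1 := by
      rw [hS', ← Matrix.map_mul, Matrix.nonsing_inv_mul S hS, Matrix.map_one _ (map_zero f) (map_one f)]
    exact Matrix.inv_eq_left_inv h1
  have hconj : S'⁻¹ * A.map f * S' = companion (f ∘ a) := by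
    rw [hS'inv, hS', ← Matrix.map_mul, ← Matrix.map_mul, hSA, companion_map]
  -- `S'⁻¹ B S'` commutes with the companion matrix
  have hB' : Commute (companion (f ∘ a)) (S'⁻¹ * B * S') := by
    rw [← hconj]
    change S'⁻¹ * A.map f * S' * (S'⁻¹ * B * S') = S'⁻¹ * B * S' * (S'⁻¹ * A.map f * S')
    calc S'⁻¹ * A.map f * S' * (S'⁻¹ * B * S') = S'⁻¹ * A.map f * (S' * S'⁻¹) * B * S' := by simp only [Matrix.mul_assoc]
      _ = S'⁻¹ * (A.map f * B) * S' := by rw [Matrix.mul_nonsing_inv S' hS'det, Matrix.mul_one]; simp only [Matrix.mul_assoc]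
      _ = S'⁻¹ * (B * A.map f) * S' := by rw [hB.eq]
      _ = S'⁻¹ * B * (S' * S'⁻¹) * A.map f * S' := by rw [Matrix.mul_nonsing_inv S' hS'det, Matrix.mul_one]; simp only [Matrix.mul_assoc]
      _ = S'⁻¹ * B * S' * (S'⁻¹ * A.map f * S') := by simp only [Matrix.mul_assoc]
  obtain ⟨p, hp, hBp⟩ := exists_eq_aeval_companion_of_commute_ring (f ∘ a) _ hB'
  refine ⟨p, hp, ?_⟩
  -- undo the conjugation: `p(S'⁻¹ A' S') = S'⁻¹ p(A') S'`
  rw [← hconj, aeval_conj_eq _ _ hS'det] at hBp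
  calc B = S' * (S'⁻¹ * B * S') * S'⁻¹ := by
          rw [Matrix.mul_assoc, Matrix.mul_assoc, Matrix.mul_nonsing_inv S' hS'det, Matrix.mul_one,
            Matrix.mul_nonsing_inv_cancel_left S' B hS'det]
    _ = S' * (S'⁻¹ * aeval (A.map f) p * S') * S'⁻¹ := by rw [hBp]
    _ = aeval (A.map f) p := by
          rw [Matrix.mul_assoc, Matrix.mul_assoc, Matrix.mul_nonsing_inv S' hS'det, Matrix.mul_one,
            Matrix.mul_nonsing_inv_cancel_left S' _ hS'det]

/-- **The commutant of `A ⊗ 1` is commutative** (`q_A = p_A`, any commutative `K`-algebra `R`): two matrices over `R` commuting with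
`A.map (algebraMap K R)` commute with each other. [cite: HornJohnson2013, 3.2.P1, p0247] -/
theorem commute_of_commute_map_of_minpoly_eq_charpoly {m : ℕ} (A : Matrix (Fin m) (Fin m) K) (hA : minpoly K A = A.charpoly)
    {B B' : Matrix (Fin m) (Fin m) R} (hB : Commute (A.map (algebraMap K R)) B) (hB' : Commute (A.map (algebraMap K R)) B') :
    Commute B B' := by
  obtain ⟨p, -, hp⟩ := exists_eq_aeval_map_of_commute A hA B hB
  obtain ⟨q, -, hq⟩ := exists_eq_aeval_map_of_commute A hA B' hB'
  rw [hp, hq]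
  exact (Commute.all p q).map (aeval (A.map (algebraMap K R)))

end BaseChange

/-! ## §3 Separable characteristic polynomial ⇒ nonderogatory -/

section Separable

variable {K : Type u} [Field K] {n : Type*} [Fintype n] [DecidableEq n]

/-- **A matrix with separable characteristic polynomial is nonderogatory: `q_A = p_A`** (over the algebraic closure `p_A` is a product
of DISTINCT linear factors, each a factor of `q_A`; divisibility descends). [cite: HornJohnson2013, Thm 3.3.15, p0257] -/
theorem minpoly_eq_charpoly_of_charpoly_separable (A : Matrix n n K) (hA : A.charpoly.Separable) : minpoly K A = A.charpoly := by
  -- `p_A ∣ q_A`: check over the algebraic closure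
  have hdvd : A.charpoly ∣ minpoly K A := by
    let ι : K →+* AlgebraicClosure K := algebraMap K (AlgebraicClosure K)
    rw [← Polynomial.map_dvd_map ι ι.injective (Matrix.charpoly_monic A)]
    have hsplit : (A.charpoly.map ι).Splits := IsAlgClosed.splits _
    have hsep : (A.charpoly.map ι).Separable := hA.map
    have hne : (minpoly K A).map ι ≠ 0 := Polynomial.map_ne_zero (minpoly.ne_zero (Matrix.isIntegral A))
    -- every root of `p_A` (over `K̄`) is a root of `q_A`
    have hroots : (A.charpoly.map ι).roots ≤ ((minpoly K A).map ι).roots := by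
      rw [Multiset.le_iff_subset (nodup_roots hsep)]
      intro μ hμ
      rw [mem_roots hne]
      rw [mem_roots (Polynomial.map_ne_zero (Matrix.charpoly_monic A).ne_zero)] at hμ
      -- `μ` is a root of the characteristic polynomial of `A.map ι`, hence of its minimal polynomial, which divides `q_A.map ι`
      have hμ' : (A.map ι).charpoly.IsRoot μ := by rwa [Matrix.charpoly_map]
      have hmin : (minpoly (AlgebraicClosure K) (A.map ι)).IsRoot μ :=
        Literature.NumberTheory.EllipticCurves.DeligneSerre1974.isRoot_minpoly_of_isRoot_charpoly _ hμ'
      have hdvd' : minpoly (AlgebraicClosure K) (A.map ι) ∣ (minpoly K A).map ι := by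
        apply minpoly.dvd
        have hAι : A.map ι = (Algebra.ofId K (AlgebraicClosure K)).mapMatrix A := rfl
        rw [Polynomial.aeval_map_algebraMap, hAι, Polynomial.aeval_algHom_apply, minpoly.aeval, map_zero]
      exact hmin.dvd hdvd'
    calc A.charpoly.map ι = ((A.charpoly.map ι).roots.map fun μ => X - Polynomial.C μ).prod :=
            hsplit.eq_prod_roots_of_monic ((Matrix.charpoly_monic A).map ι)
      _ ∣ (minpoly K A).map ι := (Multiset.prod_X_sub_C_dvd_iff_le_roots hne _).mpr hroots
  exact Polynomial.eq_of_monic_of_associated (minpoly.monic (Matrix.isIntegral A)) (Matrix.charpoly_monic A)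
    (associated_of_dvd_dvd (Matrix.minpoly_dvd_charpoly A) hdvd)

/-- **The commutant of `A ⊗ 1` is commutative for `A` with SEPARABLE characteristic polynomial** (regular semisimple), over any
commutative `K`-algebra `R`: the shape the centralisers of a regular semisimple rational element in the local and adelic matrix
groups need. [cite: HornJohnson2013, 3.2.P1, p0247] -/
theorem commute_of_commute_map_of_charpoly_separable {R : Type*} [CommRing R] [Algebra K R] {m : ℕ} (A : Matrix (Fin m) (Fin m) K)
    (hA : A.charpoly.Separable) {B B' : Matrix (Fin m) (Fin m) R} (hB : Commute (A.map (algebraMap K R)) B)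
    (hB' : Commute (A.map (algebraMap K R)) B') : Commute B B' :=
  commute_of_commute_map_of_minpoly_eq_charpoly A (minpoly_eq_charpoly_of_charpoly_separable A hA) hB hB'

/-- Every matrix over `R` commuting with `A ⊗ 1` (`p_A` separable) is a polynomial in `A ⊗ 1`. [cite: HornJohnson2013, Thm 3.2.4.2, p0236] -/
theorem exists_eq_aeval_map_of_commute_of_charpoly_separable {R : Type*} [CommRing R] [Algebra K R] {m : ℕ}
    (A : Matrix (Fin m) (Fin m) K) (hA : A.charpoly.Separable) (B : Matrix (Fin m) (Fin m) R)
    (hB : Commute (A.map (algebraMap K R)) B) : ∃ p : R[X], p.degree < (m : ℕ) ∧ B = aeval (A.map (algebraMap K R)) p :=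
  exists_eq_aeval_map_of_commute A (minpoly_eq_charpoly_of_charpoly_separable A hA) B hB

end Separable

end Literature.LinearAlgebra.Matrix
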